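import Summits.QuantumFields.YangMills.Theorems.FluctuationComparisonRegPrIntLS2BetaTubeGrowthOfHessianPosDock
import Summits.QuantumFields.YangMills.Theorems.FluctuationComparisonRegPrIntLS2BetaFlatSecondVariationAlongCurve
import Summits.QuantumFields.YangMills.Theorems.FluctuationComparisonRegPrIntLS2BetaTubeOfRecordTransversal
import Summits.QuantumFields.YangMills.Theorems.FluctuationComparisonRegPrIntLS2BetaResidualGaugeCentral
import HarnessLib

/-!
# S2β · THE FLAT INHABITANT OF THE (T)-CHAIN — brick 4: HESS∘ at `(V ≡ 1, U₀ ≡ 1)` for the chart and tube of record, and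
# TUBE♭(1, 1) ⟸ ISOL∘(δ) with every other letter discharged

Cell `ym3-torus` (YM ladder rung R3 = continuum `SU(2)` Yang–Mills on the three-torus at fixed lattice data — a RUNG: NOT d = 4, NOT infinite volume,
NOT a mass gap, NOT Clay).  Width seat `ym3-torus-px16` (gen 17), brick 4 of the «FLAT INHABITANT of the (T)-chain» pen (★★OWNER g40 №238; px21 g18 GO
22:49Z; offered to px21∕px13 23:36Z, unclaimed).  Crux `stmt-QuantumFields-20520` (`…Theses.UnitScaleTilt.FluctuationComparisonRegPrIntL`), LINE S2β;
`--kind proof --supports stmt-QuantumFields-20520 --as helper`: count-neutral, DEFINITION-FREE (0 `def`, 0 `instance`, 0 `notation`, 0 `sorry`, default heartbeats).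

WHY.  ✓(T3) `…S2BetaTubeGrowthOfHessianPosDock.exists_chart_tubeGrowth_of_hessian_pos_of_isolated` (px21 g18, RECORD 17fo) reads, for every datum
`(V, U₀)`: TUBE♭(V, U₀) ⟸ {HESS∘(Φ∘σ of record), ISOL∘(δ)}.  Bricks 1–3 (✓`…S2BetaFlatFibreTangent`, ✓`…S2BetaFlatSecondVariationAlongCurve`,
✓`…S2BetaTubeOfRecordTransversal`) prove HESS∘ at the flat datum from the tube rows.  THIS FILE ASSEMBLES: §1 HESS∘ at `(1, 1)` for the chart and tube of
record from their rows; §2 the (T)-chain READ AT THE FLAT DATUM with HESS∘ DISCHARGED — `∃ γ₁ > 0, ∀ member γ ≤ γ₁, ∀ J ≤ K, ∀ admissible ε₀`, if the flat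
configuration is a good history, then `∀ δ, ISOL∘(δ)(1,1) → TUBE♭(1,1)`.  An INHABITANT: the chain's hypotheses are jointly satisfiable and its HESS∘ socket
is filled by a kernel theorem at one datum.

WHAT.
* §1 ★★★`hessPos_flat_of_tube_rows`: tube rows (D0)(F4a) with frozen value `U₀ = 1`, `Φ (σ 0) = U₀`, `C²` composite, off-pivot agreement and flat-fibre-
  valuedness near `0` ⟹ `∀ y ≠ 0, 0 < fderiv ℝ (fderiv ℝ (A ∘ Φ ∘ σ)) 0 y y`; the iterated linearised averaging `Q` (bricks 1–2's parameter) is built by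
  `Nat.rec` inside the proof, so the statement is `Q`-free.
* §2 ★★★★`exists_tubeGrowth_flat_of_isolated`: (T3)'s ∃-theorem at `V := 1`, `U₀ := 1`, same `γ₁ = min(γ₁^{Laplace}, γ₁^{regime})`, chart∕tube of record
  obtained by ✓`exists_laplaceRows` ∕ ✓`exists_tubularHaarChart_pivotAct_local` exactly as there; EXW∘'s base-point rows by lit ✓`one_mem_regFibrePr_one` ∕
  ✓`minActionRegPr_one` ∕ ✓`minAction_one`; `D 1 = 1` by ✓`descendTo_one_eml`; `C²` by ✓(T2e) `contDiffAt_coeField_windowChart_of_histGood`; HESS∘ by §1;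
  then ✓(T3) `tubeGrowth_of_hessian_pos_of_isolated_of_clauses`.  Remaining hypotheses: `1 ∈ histGood` (the flat configuration is a good history — true
  for `θ ≥ 0`, kept as a displayed row) and ISOL∘(δ) at `(1,1)`.

HONEST.  One datum (the flat one); TUBE♭(1,1) is CONDITIONAL on ISOL∘(δ)(1,1) (orbit isolation of the flat minimiser among good histories of the flat
fibre; cf. ✓px17 `…IsolOfOrbBar`, ✓`RegArgminFlat.argmin_one_eq_orbit_of_prop7At` for L ≥ 5) and on `1 ∈ histGood`; HESS∘ at a general datum
([Balaban1985BackgroundPropagators] Thm 3.11, K-uniform), ISOL∘(δ), TUBE-REG∘ (K-uniform μ), GAP♯∘, EXW∘, S2β and crux 20520 are NOT proved; rung R3 =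
`YM3TorusSU2` as filed — SU(2) YM₃ on T³; the Yang–Mills mass gap is NOT proved.
[cite: Balaban1985Variational, Thm 1 (8)-(10) p.279, (19) p.281, (142) p.299; Balaban1985UV3, (12)-(13) p.259, (18)-(22) p.260; Balaban1987RG1, (0.4) p.253]
-/

set_option autoImplicit false

noncomputable section

open Set Filter Topology Function
open scoped Matrix.Norms.L2Operator
open Literature.MathematicalPhysics.QuantumFieldTheory.Balaban1983to89
open Literature.MathematicalPhysics.QuantumFieldTheory.Balaban1983to89.T3ContinuumYM3Torus
open Literature.MathematicalPhysics.QuantumFieldTheory.Balaban1983to89.T3UnitLawDensityEML (ℰp)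
open Literature.MathematicalPhysics.QuantumFieldTheory.Balaban1983to89.T3UnitScaleTilt
open Literature.MathematicalPhysics.QuantumFieldTheory.Balaban1983to89.T3TiltDescent
open Literature.MathematicalPhysics.QuantumFieldTheory.Balaban1983to89.T3ConstrainedMinimiser (fibre)
open Literature.MathematicalPhysics.QuantumFieldTheory.Balaban1983to89.T3PrintedRegularMinimiser
open Literature.MathematicalPhysics.QuantumFieldTheory.Balaban1983to89.T4Continuum
open Literature.MathematicalPhysics.QuantumFieldTheory.Balaban1983to89.ExpMeanLog (deltaSU expMeanLogSU)
open Literature.MathematicalPhysics.QuantumFieldTheory.Balaban1983to89.BlockAveraging (Idx)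
open Literature.MathematicalPhysics.QuantumFieldTheory.Balaban1983to89.HaarExponentialChart
open Literature.MathematicalPhysics.QuantumFieldTheory.Balaban1983to89.LogChartProduct
open Literature.MathematicalPhysics.QuantumFieldTheory.Balaban1983to89.BlockAveragingEMLLinearised (linAvg)
open scoped Literature.MathematicalPhysics.QuantumFieldTheory.Balaban1983to89.T3OrbitAverage
open Literature.MathematicalPhysics.QuantumFieldTheory.Balaban1983to89.Node00 (coeField)
open Summit.QuantumFields.YangMills.Theorems.FluctuationComparisonRegPrIntLWregChain (iterCentralBond)
open Summit.QuantumFields.YangMills.Theorems.FluctuationComparisonRegPrIntLWregGlue (WindowChart)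
open Summit.QuantumFields.YangMills.Theorems.FluctuationComparisonRegPrIntLS2BetaResidualSubgroup
open Summit.QuantumFields.YangMills.Theorems.FluctuationComparisonRegPrIntLS2BetaSignedComb (combTransporter)
open Summit.QuantumFields.YangMills.Theorems.FluctuationComparisonRegPrIntLS2BetaSignedCombKill (combSet)
open Summit.QuantumFields.YangMills.Theorems.FluctuationComparisonRegPrIntLS2BetaTubeGrowthOfHessianPosDock (tubeGrowth_of_hessian_pos_of_isolated_of_clauses)
open Summit.QuantumFields.YangMills.Theorems.FluctuationComparisonRegPrIntLS2BetaCoeFieldSmoothWindowChart (contDiffAt_coeField_windowChart_of_histGood)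
open Summit.QuantumFields.YangMills.Theorems.FluctuationComparisonRegPrIntLS2BetaChartContLaplaceRows (exists_laplaceRows)
open Summit.QuantumFields.YangMills.Theorems.FluctuationComparisonRegPrIntLS2BetaTubularChartDockLocal (exists_tubularHaarChart_pivotAct_local)
open Summit.QuantumFields.YangMills.Theorems.FluctuationComparisonRegPrIntLS2BetaPeanoSmooth (exists_gamma_chainRegime)
open Summit.QuantumFields.YangMills.Theorems.FluctuationComparisonRegPrIntLS2BetaFlatSecondVariationAlongCurve (hessPos_flat_of_transversal)
open Summit.QuantumFields.YangMills.Theorems.FluctuationComparisonRegPrIntLS2BetaTubeOfRecordTransversal (transversal_of_tube_rows)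
open Summit.QuantumFields.YangMills.Theorems.FluctuationComparisonRegPrIntLS2BetaResidualGaugeCentral (descendTo_one_eml)

namespace Summit.QuantumFields.YangMills.Theorems.FluctuationComparisonRegPrIntLS2BetaFlatTubeGrowthOfIsolated

variable (F : T3Family) {J K : ℕ} (hJK : J ≤ K)

/-! ## §1 HESS∘ at the flat datum for the tube rows and a centre-editing `Φ` -/

/-- ★★★ **HESS∘ AT THE FLAT DATUM FROM THE TUBE ROWS.**  `σ` the tube of record with frozen value `U₀ = 1` (rows (D0) comb∕pivot-frozen, (F4a) free-bond
exponential coordinates `eV`), `Φ` any map with `Φ (σ 0) = U₀`, `C²` composite `coeField ∘ Φ ∘ σ` at `0`, agreeing with the identity off the pivots near `0`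
and valued in the flat fibre near `0` ⟹ `0 < D²(A ∘ Φ ∘ σ)(0)(y,y)` for `y ≠ 0`.  Assembly of ✓brick 2 `hessPos_flat_of_transversal` (HESS∘-flat ⟸ `hT`) and
✓brick 3 `transversal_of_tube_rows` (`hT` for the tube rows); the iterated linearised averaging `Q` is built by recursion inside the proof.
[cite: Balaban1985Variational, (142) p.299, (19) p.281; Balaban1985UV3, (18)-(22) p.260] -/
theorem hessPos_flat_of_tube_rows (hk : K - J ≤ (F.P K).m + (F.P K).K) {dV : ℕ}
    [DecidablePred (· ∈ (combSet (K - J) : Set (PBond (F.P K) 0)) ∪ Set.range (iterCentralBond (P := F.P K) (K - J)))]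
    (Φ : GaugeField (F.P K) 0 (Matrix.specialUnitaryGroup (Fin 2) ℂ) → GaugeField (F.P K) 0 (Matrix.specialUnitaryGroup (Fin 2) ℂ))
    (U₀ : GaugeField (F.P K) 0 (Matrix.specialUnitaryGroup (Fin 2) ℂ))
    (σ : EuclideanSpace ℝ (Fin dV) → GaugeField (F.P K) 0 (Matrix.specialUnitaryGroup (Fin 2) ℂ))
    (eV : EuclideanSpace ℝ (Fin dV) ≃L[ℝ] (piLogChart (specialUnitaryLogChart (Fin 2)) {b : PBond (F.P K) 0 // b ∉ (combSet (K - J) : Set (PBond (F.P K) 0)) ∪ Set.range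
          (iterCentralBond (P := F.P K) (K - J))}).lie)
    (hσcomb : ∀ y, ∀ b ∈ (combSet (K - J) : Set (PBond (F.P K) 0)) ∪ Set.range (iterCentralBond (P := F.P K) (K - J)), σ y b = U₀ b)
    (hσfree : ∀ y (b : PBond (F.P K) 0) (hb : b ∉ (combSet (K - J) : Set (PBond (F.P K) 0)) ∪ Set.range (iterCentralBond (P := F.P K) (K - J))),
        σ y b = U₀ b * ((combTransporter (K - J) U₀ b.tgt)⁻¹ *
          (isChartRep_specialUnitaryGroup (n := Fin 2)).expChart
            (lieApply (specialUnitaryLogChart (Fin 2)) {b : PBond (F.P K) 0 // b ∉ (combSet (K - J) : Set (PBond (F.P K) 0)) ∪ Set.range (iterCentralBond (P := F.P K) (K - J))} (eV y) ⟨b, hb⟩) *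
          combTransporter (K - J) U₀ b.tgt))
    (hU₀ : U₀ = 1) (hΦ0 : Φ (σ 0) = U₀)
    (hC2 : ContDiffAt ℝ 2 (fun y => coeField (Φ (σ y))) 0)
    (hoff : ∀ᶠ y in 𝓝 (0 : EuclideanSpace ℝ (Fin dV)), ∀ b : PBond (F.P K) 0,
      (∀ c', iterCentralBond (P := F.P K) (K - J) c' ≠ b) → Φ (σ y) b = σ y b)
    (hfib : ∀ᶠ y in 𝓝 (0 : EuclideanSpace ℝ (Fin dV)), descendTo F ℰp J K hJK (Φ (σ y)) = 1) :
    ∀ y : EuclideanSpace ℝ (Fin dV), y ≠ 0 → 0 < fderiv ℝ (fderiv ℝ (fun y => wilsonAction4 (Φ (σ y)))) 0 y y := by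
  -- the iterated linearised averaging, by recursion (the conclusion does not mention it)
  obtain ⟨Q, hQ0, hQs⟩ : ∃ Q : (i : ℕ) → (PBond (F.P K) 0 → Matrix (Fin 2) (Fin 2) ℂ) → PBond (F.P K) i → Matrix (Fin 2) (Fin 2) ℂ,
      (∀ Y, Q 0 Y = Y) ∧ ∀ (i : ℕ) (Y : PBond (F.P K) 0 → Matrix (Fin 2) (Fin 2) ℂ) (c : PBond (F.P K) (i + 1)), Q (i + 1) Y c = linAvg (Q i Y) c :=
    ⟨fun i => Nat.rec (motive := fun i => (PBond (F.P K) 0 → Matrix (Fin 2) (Fin 2) ℂ) → PBond (F.P K) i → Matrix (Fin 2) (Fin 2) ℂ)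
        (fun Y => Y) (fun i q Y c => linAvg (q Y) c) i, fun Y => rfl, fun i Y c => rfl⟩
  have hΨ0 : Φ (σ 0) = 1 := hΦ0.trans hU₀
  have hT := transversal_of_tube_rows F hk Φ U₀ σ eV hσcomb hσfree hoff (hC2.differentiableAt (by simp))
  exact hessPos_flat_of_transversal F hJK Q hQ0 hQs (Ψ := fun y => Φ (σ y)) hC2 hΨ0 hfib hT

/-! ## §2 The (T)-chain at the flat datum: TUBE♭(1,1) ⟸ ISOL∘(δ) -/

/-- ★★★★ **THE (T)-CHAIN AT THE FLAT DATUM `(V ≡ 1, U₀ ≡ 1)` WITH HESS∘ DISCHARGED: ∃ γ₁, ∀ member ∕ depth ∕ admissible `ε₀`, if the flat configuration is a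
good history then ∀ δ, ISOL∘(δ) ⟹ TUBE♭(1, 1).**  This is ✓(T3) `exists_chart_tubeGrowth_of_hessian_pos_of_isolated` read at the flat datum, with the
chart and tube of record obtained inside exactly as there, EXW∘'s base-point rows discharged by lit ✓`one_mem_regFibrePr_one` ∕ ✓`minActionRegPr_one`,
and the HESS∘ letter PROVED by §1 (its rows: `C²` ⟸ ✓(T2e); `Φ (σ 0) = 1` ⟸ `hself`; off-pivot agreement and flat-fibre-valuedness near `0` ⟸
`hoffT`+`hne`+`hnhds`+`Continuous σ`; `D 1 = 1` ⟸ ✓`descendTo_one_eml`).  The only letter left at the flat datum is ISOL∘(δ).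
[cite: Balaban1985Variational, Thm 1 (8)-(10) p.279, (142) p.299; Balaban1985UV3, (12)-(13) p.259, (18)-(22) p.260; Balaban1987RG1, (0.4) p.253, (2.10) p.267] -/
theorem exists_tubeGrowth_flat_of_isolated (L : ℕ) (b₀ p₀ : ℝ) (hb : 0 < b₀) (hp : 0 < p₀) :
    ∃ γ₁ : ℝ, 0 < γ₁ ∧ ∀ (F : T3Family) (γ : ℝ), F.L = L → 0 < γ → γ ≤ γ₁ →
      ∀ (J K : ℕ) (hJK : J ≤ K) (hk : K - J ≤ (F.P K).m + (F.P K).K)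
        (ε₀ : ℝ), 0 < ε₀ → (143 * ((((3 + 4 : ℕ) : ℝ)) ^ 2 / 4) ^ 2) * (2 * ε₀) ≤ 1 / 3 →
          2 * (2 * ε₀) ≤ 2 * deltaSU (Fin 2) / (((3 + 4) * F.L : ℕ) : ℝ) ^ 2 →
        (1 : GaugeField (F.P K) 0 (Matrix.specialUnitaryGroup (Fin 2) ℂ)) ∈ histGood F ℰp (θBal F.L γ b₀ p₀) K J →
        ∀ δ : ℝ,
          (∀ U ∈ closure (fibre F ℰp J K hJK (1 : GaugeField (F.P J) 0 (Matrix.specialUnitaryGroup (Fin 2) ℂ)) ∩ histGood F ℰp (θBal F.L γ b₀ p₀) K J),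
            (∃ w : Site (F.P K) 0 → Matrix.specialUnitaryGroup (Fin 2) ℂ,
              (∀ U'' : GaugeField (F.P K) 0 (Matrix.specialUnitaryGroup (Fin 2) ℂ),
                  descendTo F ℰp J K hJK (GaugeField.gaugeAct w U'') = descendTo F ℰp J K hJK U'') ∧
                ∀ ℓ : PBond (F.P K) 0, dist1 (U ℓ * ((GaugeField.gaugeAct w (1 : GaugeField (F.P K) 0 (Matrix.specialUnitaryGroup (Fin 2) ℂ))) ℓ)⁻¹) ≤ δ) →
            wilsonAction4 U ≤ minActionRegPr F J K hJK ε₀ (1 : GaugeField (F.P J) 0 (Matrix.specialUnitaryGroup (Fin 2) ℂ)) →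
            (⨅ w : {w : Site (F.P K) 0 → Matrix.specialUnitaryGroup (Fin 2) ℂ |
                ∀ U : GaugeField (F.P K) 0 (Matrix.specialUnitaryGroup (Fin 2) ℂ),
                  descendTo F ℰp J K hJK (GaugeField.gaugeAct w U) = descendTo F ℰp J K hJK U},
              ∑ ℓ : PBond (F.P K) 0,
                dist1 (U ℓ * ((GaugeField.gaugeAct (w : Site (F.P K) 0 → Matrix.specialUnitaryGroup (Fin 2) ℂ) (1 : GaugeField (F.P K) 0 (Matrix.specialUnitaryGroup (Fin 2) ℂ))) ℓ)⁻¹) ^ 2) = 0) →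
    ∃ μ : ℝ, 0 < μ ∧ ∀ U ∈ fibre F ℰp J K hJK (1 : GaugeField (F.P J) 0 (Matrix.specialUnitaryGroup (Fin 2) ℂ)), U ∈ histGood F ℰp (θBal F.L γ b₀ p₀) K J →
      (∃ w : Site (F.P K) 0 → Matrix.specialUnitaryGroup (Fin 2) ℂ,
        (∀ U'' : GaugeField (F.P K) 0 (Matrix.specialUnitaryGroup (Fin 2) ℂ),
            descendTo F ℰp J K hJK (GaugeField.gaugeAct w U'') = descendTo F ℰp J K hJK U'') ∧
          ∀ ℓ : PBond (F.P K) 0, dist1 (U ℓ * ((GaugeField.gaugeAct w (1 : GaugeField (F.P K) 0 (Matrix.specialUnitaryGroup (Fin 2) ℂ))) ℓ)⁻¹) ≤ δ) →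
      μ * ((F.L : ℝ)⁻¹) ^ (2 * (K - J)) *
          (⨅ w : {w : Site (F.P K) 0 → Matrix.specialUnitaryGroup (Fin 2) ℂ |
              ∀ U : GaugeField (F.P K) 0 (Matrix.specialUnitaryGroup (Fin 2) ℂ),
                descendTo F ℰp J K hJK (GaugeField.gaugeAct w U) = descendTo F ℰp J K hJK U},
            ∑ ℓ : PBond (F.P K) 0,
              dist1 (U ℓ * ((GaugeField.gaugeAct (w : Site (F.P K) 0 → Matrix.specialUnitaryGroup (Fin 2) ℂ) (1 : GaugeField (F.P K) 0 (Matrix.specialUnitaryGroup (Fin 2) ℂ))) ℓ)⁻¹) ^ 2)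
        ≤ wilsonAction4 U - minActionRegPr F J K hJK ε₀ (1 : GaugeField (F.P J) 0 (Matrix.specialUnitaryGroup (Fin 2) ℂ)) := by
  classical
  obtain ⟨γ₁, hγ₁, hmain⟩ := exists_laplaceRows L b₀ p₀ hb hp
  obtain ⟨α, γ₂, hα0, hα24, hαδ, hγ₂, hreg⟩ := exists_gamma_chainRegime L b₀ p₀ hb hp
  refine ⟨min γ₁ γ₂, lt_min hγ₁ hγ₂, ?_⟩
  intro F γ hFL hγ hγle J K hJK hk ε₀ hε₀ hr3 hr2 h1h δ hisol
  obtain ⟨c, T, w, h137, h138, h139, -, -, -, h144, h145, -, -, h153, h154, -⟩ := hmain F γ hFL hγ (hγle.trans (min_le_left _ _)) J K hJK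
  obtain ⟨hαL, hθ0, hθα⟩ := hreg F γ hFL hγ (hγle.trans (min_le_right _ _)) K
  obtain ⟨e, σ, eV, UZ, UV, jZ, jV, ρ, -, he1, -, hσc, hσ0, hσs, hσcomb, -, hσfree, -, -, -, -, h0Z, h0V, -, hF3, -⟩ :=
    exists_tubularHaarChart_pivotAct_local F hJK hk _ _ rfl rfl (1 : GaugeField (F.P K) 0 (Matrix.specialUnitaryGroup (Fin 2) ℂ))
  -- EXW∘'s base point at the flat datum: the flat configuration is print's regular minimiser of its own (flat) fibre
  have hU₀V : descendTo F ℰp J K hJK (1 : GaugeField (F.P K) 0 (Matrix.specialUnitaryGroup (Fin 2) ℂ)) = 1 := descendTo_one_eml F hJK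
  have hU₀reg : (1 : GaugeField (F.P K) 0 (Matrix.specialUnitaryGroup (Fin 2) ℂ)) ∈ regFibrePr F J K hJK ε₀ (1 : GaugeField (F.P J) 0 (Matrix.specialUnitaryGroup (Fin 2) ℂ)) :=
        one_mem_regFibrePr_one F hε₀
  have hmin : wilsonAction4 (1 : GaugeField (F.P K) 0 (Matrix.specialUnitaryGroup (Fin 2) ℂ)) = minActionRegPr F J K hJK ε₀ (1 : GaugeField (F.P J) 0 (Matrix.specialUnitaryGroup (Fin 2) ℂ)) := by
    rw [minActionRegPr_one F hε₀, ← T3DescentFibreTower.minAction_self F ℰp K 1]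
    exact T3DescentFibreTower.minAction_one F ℰp T3DescentFibreTower.expMeanLogSU_E_one le_rfl
  have hU₀cl : (1 : GaugeField (F.P K) 0 (Matrix.specialUnitaryGroup (Fin 2) ℂ)) ∈ closure (histGood F ℰp (θBal F.L γ b₀ p₀) K J) := subset_closure h1h
  obtain ⟨hlive, hself1⟩ := h144 1 1 hU₀V hU₀cl
  have hoffz : ∀ z, c.jac (1, z) ≠ 0 → ∀ b, (∀ c', iterCentralBond (K - J) c' ≠ b) → c.Φ (1, z) b = z b :=
    fun z hz => (h145 1 z ((h138 1 z).1 hz).1).1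
  have hnhds1 : {z | c.jac (1, z) ≠ 0} ∈ 𝓝 (1 : GaugeField (F.P K) 0 (Matrix.specialUnitaryGroup (Fin 2) ℂ)) := h153 1 1 hU₀V h1h
  have hev : ∀ᶠ y in 𝓝 (0 : EuclideanSpace ℝ (Fin _)), σ y ∈ {z | c.jac (1, z) ≠ 0} :=
    hσc.continuousAt.preimage_mem_nhds (by rw [hσ0]; exact hnhds1)
  have hoff : ∀ᶠ y in 𝓝 (0 : EuclideanSpace ℝ (Fin _)), ∀ b : PBond (F.P K) 0,
      (∀ c', iterCentralBond (P := F.P K) (K - J) c' ≠ b) → c.Φ (1, σ y) b = σ y b :=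
    hev.mono fun y hy => hoffz (σ y) hy
  have hfib : ∀ᶠ y in 𝓝 (0 : EuclideanSpace ℝ (Fin _)), descendTo F ℰp J K hJK (c.Φ (1, σ y)) = 1 :=
    hev.mono fun y hy => h137 1 (σ y) hy
  have hΦ0 : c.Φ (1, σ 0) = 1 := by rw [hσ0]; exact hself1
  have hC2 : ContDiffAt ℝ 2 (fun y => coeField (c.Φ (1, σ y))) 0 :=
    contDiffAt_coeField_windowChart_of_histGood F hJK hk hα24 hαδ hαL hθ0 hθα c 1 1 (h137 1) hoffz (h139 1).1 hlive hself1 hnhds1 hU₀V h1h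
      σ hσc hσ0 hσs 2
  have hH := hessPos_flat_of_tube_rows F hJK hk (fun z => c.Φ (1, z)) 1 σ eV hσcomb hσfree rfl hΦ0 hC2 hoff hfib
  exact tubeGrowth_of_hessian_pos_of_isolated_of_clauses F hJK hk hα24 hαδ hαL hθ0 hθα hε₀ hr3 hr2 c T w 1 (h137 1) (h138 1) (h139 1).1 (h144 1)
    (h145 1) (h153 1) (h154 1) 1 hU₀reg h1h hmin e σ he1 hσc hσ0 hσs h0Z h0V hF3 δ hH hisol

end Summit.QuantumFields.YangMills.Theorems.FluctuationComparisonRegPrIntLS2BetaFlatTubeGrowthOfIsolated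

end
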